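import Summits.CriticalPhenomena.PercolationContinuityZ3.Theorems.Transplant.FKConnectivityAllQAntipodalRootFormRealBox
import Summits.CriticalPhenomena.PercolationContinuityZ3.Theorems.Transplant.FKConnectivityAllQAntipodalRootFormHost
import Summits.CriticalPhenomena.PercolationContinuityZ3.Theorems.Transplant.FKConnectivityAllQAntipodalMinorGluing
import HarnessLib

/-!
# Connectivity correlation inequalities for `φ_{w,q}`, every `q > 0` — ROOT-FORM CALCULUS, file 61o: the PAIR ENVIRONMENT `B_y ∥ B_z` and
# **the `q`-free `maj₃` inequality on EVERY host `x ∥ B_y ∥ B_z`** (all two-terminal series–parallel boxes, every cell)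

Support file (`--supports stmt-CriticalPhenomena-4575`), FK sub-lane `prim-bschramm-fk-2` (gen 29); builds on p205010 (kernel theorem,
internal audit signed; external expert review pending).  No definitions, no named facts, no sorries; standard axioms.  Memo
FROM-fk-2-g28-ROOT-FORM.md §4, §7 (L4b–c); FK-Q2 §37–§38.

`B_y`, `B_z` two-terminal series–parallel between common poles `c, d`, edge-disjoint, their vertex sets meeting only in `{c,d}`, with special
edges `y ∈ B_y`, `z ∈ B_z` and cells `(M_y, C_y)`, `(M_z, C_z)`.  By the parallel gluing law (`FK.apExpC_parallel`, `FK.reachable_union_parallel`)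
the real environment of `B_y ∪ B_z` (file 61k) at `β_y ∪ β_z` is the abstract pair environment `thetaPair (realBox …y) (realBox …z)` of file 61e at
`(β_y, β_z)` with every level lowered by `2|V|` (`realEnv_pair_slot1/0`); hence its nested root functional is that of the abstract pair
(`Mt_realEnv_pair`) and **fact 1 holds for the real pair environment** (`realPairEnv_Mt_nonneg`, from THEOREM G27 for real boxes,
`FK.RootForm.realPair_Mt_nonneg`, file 61m).  With the root identity (file 61n):
**`FK.RootForm.maj3_levels_le_nonpos_theta`** — for every host `H = x ∥ B_y ∥ B_z` (`x = cd ∉ B_y ∪ B_z`), every cell with `x, y, z` free, every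
increasing `g` blind to `x, y, z` and every level `J`, the level-`J` partial sum of the antipodal form of `maj₃(ω_x,ω_y,ω_z)` against `g` is `≤ 0`:
`Z_H(z,q)² Cov_{φ_{z,q}}(maj₃, g) ∈ (q−1)·ℝ≥0[z,q]`.  This is the black-box theta law ★(Θ) of the memos for the EMPTY spine word and ALL boxes —
the two-ear theta hosts of gen 23 (`FK.apPsiC_levels_le_maj3_nonpos_of_theta`) are the case `B_y = ` one ear; here `B_y, B_z` are arbitrary.
[cite: Grimmett2006, §1.4 eq. (1.20) (p. 15); §3.8 Thm. (3.90) (pp. 61–62)] [cite: Wagner2006, Thm. 5.8(d), §5.3]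
-/

noncomputable section

namespace Summit.CriticalPhenomena.PercolationContinuityZ3.Theorems

namespace FK

namespace RootForm

open SimpleGraph Finset Literature.Probability.LatticeModels Literature.Probability.Percolation
open scoped Classical

variable {V : Type*} [Fintype V]

section Pair

variable {B B' : Finset (Sym2 V)} {c d uy vy uz vz : V} {My Cy Mz Cz : Finset (Sym2 V)}

/-- **Parallel gluing at the level of pattern data**: the `comb` of the two box data at `X_y`, `X_z` is the real pattern datum of
`B_y ∪ B_z` at `X_y ∪ X_z` with the level raised by `2|V|`. [cite: Grimmett2006, §3.8 (pp. 61–62)] -/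
theorem comb_realSDat (hB : IsTTSP B c d) (hd : Disjoint B B')
    (hV : ∀ w : V, (∃ e ∈ B, w ∈ e) → (∃ e ∈ B', w ∈ e) → w = c ∨ w = d)
    (hMy : insert s(uy, vy) My ⊆ B) (hCy : Cy ⊆ B) (hMz : insert s(uz, vz) Mz ⊆ B') (hCz : Cz ⊆ B')
    {Xy Xz : Finset (Sym2 V)} (hXy : Xy ⊆ insert s(uy, vy) My) (hXz : Xz ⊆ insert s(uz, vz) Mz)
    {X : Finset (Sym2 V)} (hX : X = Xy ∪ Xz) :
    Base.comb (realSDat My Cy c d s(uy, vy) Xy) (realSDat Mz Cz c d s(uz, vz) Xz) =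
      ⟨(realPDat (My ∪ Mz) (Cy ∪ Cz) c d s(uy, vy) s(uz, vz) X).lam + 2 * Fintype.card V,
        (realPDat (My ∪ Mz) (Cy ∪ Cz) c d s(uy, vy) s(uz, vz) X).k1, (realPDat (My ∪ Mz) (Cy ∪ Cz) c d s(uy, vy) s(uz, vz) X).k2⟩ := by
  subst hX
  have g₁ : ∀ e ∈ (↑B : Set (Sym2 V)), ∀ w ∈ e, w ∈ {w : V | ∃ e ∈ B, w ∈ e} := fun e he w hw => ⟨e, he, hw⟩
  have g₂ : ∀ e ∈ (↑B' : Set (Sym2 V)), ∀ w ∈ e, w ∈ {w : V | ∃ e ∈ B', w ∈ e} := fun e he w hw => ⟨e, he, hw⟩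
  have gS : {w : V | ∃ e ∈ B, w ∈ e} ∩ {w : V | ∃ e ∈ B', w ∈ e} ⊆ ({c, d} : Set V) := by
    intro w hw
    rcases hV w hw.1 hw.2 with h | h
    · exact Or.inl h
    · exact Or.inr h
  have hM : insert s(uy, vy) My ∪ insert s(uz, vz) Mz = insert s(uy, vy) (insert s(uz, vz) (My ∪ Mz)) := by
    rw [Finset.insert_union, Finset.union_insert]
  have k := apExpC_parallel hd g₁ g₂ gS hB.ne hMy hMz hCy hCz hXy hXz
  have r1 := reachable_union_parallel g₁ g₂ gS (Finset.union_subset (hXy.trans hMy) hCy) (Finset.union_subset (hXz.trans hMz) hCz)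
  have r2 := reachable_union_parallel g₁ g₂ gS (γ₁ := insert s(uy, vy) My \ Xy ∪ Cy) (γ₂ := insert s(uz, vz) Mz \ Xz ∪ Cz)
    (Finset.union_subset (Finset.sdiff_subset.trans hMy) hCy) (Finset.union_subset (Finset.sdiff_subset.trans hMz) hCz)
  have hdM : Disjoint (insert s(uy, vy) My) (insert s(uz, vz) Mz) :=
    Finset.disjoint_of_subset_left hMy (Finset.disjoint_of_subset_right hMz hd)
  have e1 : Xy ∪ Xz ∪ (Cy ∪ Cz) = Xy ∪ Cy ∪ (Xz ∪ Cz) := Finset.union_union_union_comm _ _ _ _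
  have e2 : insert s(uy, vy) (insert s(uz, vz) (My ∪ Mz)) \ (Xy ∪ Xz) ∪ (Cy ∪ Cz) =
      insert s(uy, vy) My \ Xy ∪ Cy ∪ (insert s(uz, vz) Mz \ Xz ∪ Cz) := by
    rw [← hM, union_sdiff_union hdM hXy hXz, Finset.union_union_union_comm]
  rw [hM] at k
  simp only [Base.comb, PDat.mk.injEq]
  refine ⟨?_, ?_, ?_⟩
  · have k' := congrArg (Nat.cast : ℕ → ℤ) k
    simp only [Nat.cast_add, Nat.cast_mul, Nat.cast_ofNat, Nat.cast_ite, Nat.cast_one, Nat.cast_zero] at k'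
    simp only [realPDat, realSDat, reachB, bit]
    by_cases h1 : (openGraph (↑(Xy ∪ Cy) : BondConfig V)).Reachable c d <;>
      by_cases h2 : (openGraph (↑(Xz ∪ Cz) : BondConfig V)).Reachable c d <;>
      by_cases h3 : (openGraph (↑(insert s(uy, vy) My \ Xy ∪ Cy) : BondConfig V)).Reachable c d <;>
      by_cases h4 : (openGraph (↑(insert s(uz, vz) Mz \ Xz ∪ Cz) : BondConfig V)).Reachable c d <;>
      simp only [h1, h2, h3, h4, and_self, and_true, and_false, if_true, if_false, decide_true, decide_false, Bool.and_self,
        Bool.and_true, Bool.and_false, Bool.false_eq_true] at k' ⊢ <;>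
      linarith
  · simp only [realPDat, realSDat, reachB, e1]
    rw [Bool.eq_iff_iff]
    simp only [Bool.or_eq_true, decide_eq_true_eq]
    exact r1.symm
  · simp only [realPDat, realSDat, reachB, e2]
    rw [Bool.eq_iff_iff]
    simp only [Bool.or_eq_true, decide_eq_true_eq]
    exact r2.symm

omit [Fintype V] in
/-- Shifting every level of the four pattern data by `κ` shifts the slot integrands' level argument. [folklore] -/
theorem EDat.slots_of_shift (e e' : EDat) (κ : ℤ) (h0 : e'.d0 = ⟨e.d0.lam + κ, e.d0.k1, e.d0.k2⟩)
    (hy : e'.dy = ⟨e.dy.lam + κ, e.dy.k1, e.dy.k2⟩) (hz : e'.dz = ⟨e.dz.lam + κ, e.dz.k1, e.dz.k2⟩)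
    (hyz : e'.dyz = ⟨e.dyz.lam + κ, e.dyz.k1, e.dyz.k2⟩) (J : ℤ) :
    e'.slot1 J = e.slot1 (J - κ) ∧ e'.slot0 J = e.slot0 (J - κ) := by
  have a1 : ∀ d : PDat, PDat.a1 ⟨d.lam + κ, d.k1, d.k2⟩ J = d.a1 (J - κ) := fun d => ind_congr (by simp only; omega)
  have a2 : ∀ d : PDat, PDat.a2 ⟨d.lam + κ, d.k1, d.k2⟩ J = d.a2 (J - κ) := fun d => ind_congr (by simp only; omega)
  have r1 : ∀ d : PDat, PDat.r1 ⟨d.lam + κ, d.k1, d.k2⟩ J = d.r1 (J - κ) := fun d =>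
    ind_congr (by simp only; constructor <;> rintro ⟨h, h'⟩ <;> exact ⟨by omega, h'⟩)
  have r2 : ∀ d : PDat, PDat.r2 ⟨d.lam + κ, d.k1, d.k2⟩ J = d.r2 (J - κ) := fun d =>
    ind_congr (by simp only; constructor <;> rintro ⟨h, h'⟩ <;> exact ⟨by omega, h'⟩)
  simp only [EDat.slot1, EDat.slot0, h0, hy, hz, hyz, a1, a2, r1, r2, and_self]

/-- **The pair environment is the real environment of `B_y ∪ B_z`** (slot by slot, levels shifted by `2|V|`). [cite: Grimmett2006, §3.8 (pp. 61–62)] -/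
theorem thetaPair_realBox_slots (hB : IsTTSP B c d) (hd : Disjoint B B')
    (hV : ∀ w : V, (∃ e ∈ B, w ∈ e) → (∃ e ∈ B', w ∈ e) → w = c ∨ w = d) (hy : s(uy, vy) ∈ B) (hz : s(uz, vz) ∈ B')
    (hMy : My ⊆ B.erase s(uy, vy)) (hCy : Cy ⊆ B.erase s(uy, vy)) (hMz : Mz ⊆ B'.erase s(uz, vz)) (hCz : Cz ⊆ B'.erase s(uz, vz))
    (β : ↥My.powerset) (γ : ↥Mz.powerset) (J : ℤ) :
    (Base.thetaPair (realBox My Cy c d s(uy, vy)) (realBox Mz Cz c d s(uz, vz)) (β, γ)).slot1 J =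
        (realEnv (My ∪ Mz) (Cy ∪ Cz) c d s(uy, vy) s(uz, vz) ⟨β.1 ∪ γ.1, Finset.mem_powerset.2
          (Finset.union_subset_union (Finset.mem_powerset.1 β.2) (Finset.mem_powerset.1 γ.2))⟩).slot1 (J - 2 * Fintype.card V) ∧
      (Base.thetaPair (realBox My Cy c d s(uy, vy)) (realBox Mz Cz c d s(uz, vz)) (β, γ)).slot0 J =
        (realEnv (My ∪ Mz) (Cy ∪ Cz) c d s(uy, vy) s(uz, vz) ⟨β.1 ∪ γ.1, Finset.mem_powerset.2
          (Finset.union_subset_union (Finset.mem_powerset.1 β.2) (Finset.mem_powerset.1 γ.2))⟩).slot0 (J - 2 * Fintype.card V) := by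
  have hMy' : insert s(uy, vy) My ⊆ B := Finset.insert_subset hy (hMy.trans (Finset.erase_subset _ _))
  have hMz' : insert s(uz, vz) Mz ⊆ B' := Finset.insert_subset hz (hMz.trans (Finset.erase_subset _ _))
  have hCy' : Cy ⊆ B := hCy.trans (Finset.erase_subset _ _)
  have hCz' : Cz ⊆ B' := hCz.trans (Finset.erase_subset _ _)
  have b0 : β.1 ⊆ insert s(uy, vy) My := (Finset.mem_powerset.1 β.2).trans (Finset.subset_insert _ _)
  have b1 : insert s(uy, vy) β.1 ⊆ insert s(uy, vy) My := Finset.insert_subset_insert _ (Finset.mem_powerset.1 β.2)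
  have c0 : γ.1 ⊆ insert s(uz, vz) Mz := (Finset.mem_powerset.1 γ.2).trans (Finset.subset_insert _ _)
  have c1 : insert s(uz, vz) γ.1 ⊆ insert s(uz, vz) Mz := Finset.insert_subset_insert _ (Finset.mem_powerset.1 γ.2)
  refine EDat.slots_of_shift _ _ (2 * Fintype.card V) ?_ ?_ ?_ ?_ J
  · exact comb_realSDat hB hd hV hMy' hCy' hMz' hCz' b0 c0 rfl
  · exact comb_realSDat hB hd hV hMy' hCy' hMz' hCz' b1 c0 (Finset.insert_union _ _ _).symm
  · exact comb_realSDat hB hd hV hMy' hCy' hMz' hCz' b0 c1 (Finset.union_insert _ _ _).symm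
  · exact comb_realSDat hB hd hV hMy' hCy' hMz' hCz' b1 c1 (by rw [Finset.insert_union, Finset.union_insert])

/-- **FACT 1 FOR THE REAL PAIR ENVIRONMENT.**  For `B_y ∥ B_z` as above, the nested root functional of the real environment
`realEnv (M_y ∪ M_z) (C_y ∪ C_z) c d y z` is nonnegative against every monotone nested nonnegative weight pair — THEOREM G27 for real boxes
transported along `(β_y, β_z) ↦ β_y ∪ β_z`. [cite: Grimmett2006, §3.8 Thm. (3.90) (pp. 61–62)] [cite: Wagner2006, Thm. 5.8(d), §5.3] -/
theorem realPairEnv_Mt_nonneg (hB : IsTTSP B c d) (hB' : IsTTSP B' c d) (hd : Disjoint B B')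
    (hV : ∀ w : V, (∃ e ∈ B, w ∈ e) → (∃ e ∈ B', w ∈ e) → w = c ∨ w = d) (hy : s(uy, vy) ∈ B) (hz : s(uz, vz) ∈ B')
    (hMy : My ⊆ B.erase s(uy, vy)) (hCy : Cy ⊆ B.erase s(uy, vy)) (hMz : Mz ⊆ B'.erase s(uz, vz)) (hCz : Cz ⊆ B'.erase s(uz, vz))
    {h0 h1 : ↥(My ∪ Mz).powerset → ℝ} (m0 : Monotone h0) (m1 : Monotone h1) (n0 : ∀ δ, 0 ≤ h0 δ) (le : ∀ δ, h0 δ ≤ h1 δ) (J : ℤ) :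
    0 ≤ Mt (realEnv (My ∪ Mz) (Cy ∪ Cz) c d s(uy, vy) s(uz, vz)) h0 h1 J := by
  have hdM : Disjoint My Mz := Finset.disjoint_of_subset_left (hMy.trans (Finset.erase_subset _ _))
    (Finset.disjoint_of_subset_right (hMz.trans (Finset.erase_subset _ _)) hd)
  let e : ↥My.powerset × ↥Mz.powerset ≃ ↥(My ∪ Mz).powerset :=
    { toFun := fun p => ⟨p.1.1 ∪ p.2.1, Finset.mem_powerset.2
        (Finset.union_subset_union (Finset.mem_powerset.1 p.1.2) (Finset.mem_powerset.1 p.2.2))⟩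
      invFun := fun δ => (⟨δ.1 ∩ My, Finset.mem_powerset.2 Finset.inter_subset_right⟩,
        ⟨δ.1 ∩ Mz, Finset.mem_powerset.2 Finset.inter_subset_right⟩)
      left_inv := fun p => by
        obtain ⟨⟨X, hX⟩, ⟨Y, hY⟩⟩ := p
        have hX' := Finset.mem_powerset.1 hX; have hY' := Finset.mem_powerset.1 hY
        refine Prod.ext (Subtype.ext ?_) (Subtype.ext ?_)
        · show (X ∪ Y) ∩ My = X
          rw [Finset.union_inter_distrib_right, Finset.inter_eq_left.2 hX',
            Finset.disjoint_iff_inter_eq_empty.1 (Finset.disjoint_of_subset_left hY' hdM.symm), Finset.union_empty]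
        · show (X ∪ Y) ∩ Mz = Y
          rw [Finset.union_inter_distrib_right, Finset.inter_eq_left.2 hY',
            Finset.disjoint_iff_inter_eq_empty.1 (Finset.disjoint_of_subset_left hX' hdM), Finset.empty_union]
      right_inv := fun δ => Subtype.ext (by
        show δ.1 ∩ My ∪ δ.1 ∩ Mz = δ.1
        rw [← Finset.inter_union_distrib_left, Finset.inter_eq_left.2 (Finset.mem_powerset.1 δ.2)]) }
  have em : ∀ {h : ↥(My ∪ Mz).powerset → ℝ}, Monotone h → Monotone (fun p => h (e p)) := fun hm p q hpq =>
    hm (show (e p).1 ⊆ (e q).1 from Finset.union_subset_union hpq.1 hpq.2)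
  have key := realPair_Mt_nonneg hB hB' hy hz hMy hCy hMz hCz (H0 := fun p => h0 (e p)) (H1 := fun p => h1 (e p))
    (em m0) (em m1) (fun p => n0 _) (fun p => le _) (J + 2 * Fintype.card V)
  unfold Mt at key ⊢
  rw [← Equiv.sum_comp e]
  refine key.trans_eq (Finset.sum_congr rfl fun p _ => ?_)
  obtain ⟨β, γ⟩ := p
  obtain ⟨hs1, hs0⟩ := thetaPair_realBox_slots (Cy := Cy) (Cz := Cz) hB hd hV hy hz hMy hCy hMz hCz β γ (J + 2 * Fintype.card V)
  rw [add_sub_cancel_right] at hs1 hs0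
  simp only [e, Equiv.coe_fn_mk, hs1, hs0]

end Pair

section Theta

variable {B B' : Finset (Sym2 V)} {c d uy vy uz vz : V} {My Cy Mz Cz : Finset (Sym2 V)}

/-- **THEOREM (★(Θ) for all boxes: the `q`-free `maj₃` inequality on every host `x ∥ B_y ∥ B_z`).**  Let `B_y`, `B_z` be two-terminal
series–parallel between `c, d`, edge-disjoint with vertex sets meeting only in `{c, d}`, `y = u_y v_y ∈ B_y`, `z = u_z v_z ∈ B_z`, and let the
root `x = cd` be a further edge (`x ∉ B_y ∪ B_z`), so that `H = B_y ∪ B_z ∪ {x}` is an arbitrary theta-type 2-connected series–parallel host with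
one special edge on each of its three branches `x`, `B_y`, `B_z`.  For every cell — `M_y, C_y ⊆ B_y \ y` and `M_z, C_z ⊆ B_z \ z` free /
contracted, the rest deleted, `x, y, z` free — every increasing `g` blind to `x, y, z` and every level `J`:
`Σ_{γ : level ≤ J} (maj₃(γ∪C) − maj₃(γᶜ∪C))·(g(γ∪C) − g(γᶜ∪C)) ≤ 0`, i.e. every coefficient, in the edge odds and in `q`, of
`Z_H(z,q)² Cov_{φ_{z,q}}(maj₃(ω_x,ω_y,ω_z), g)/(q − 1)` is nonnegative (Conjecture `C_∞⁺` at level 3 for these hosts; memo FROM-fk-2-g28 §4: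
the word theorem ★(Θ) for the empty word and ALL boxes).  Proof: root identity (file 61n) + fact 1 for the real pair environment
(`realPairEnv_Mt_nonneg` = THEOREM G27 for real boxes). [cite: Grimmett2006, §1.4 eq. (1.20) (p. 15); §3.8 Thm. (3.90) (pp. 61–62)]
[cite: Wagner2006, Thm. 5.8(d), §5.3] -/
theorem maj3_levels_le_nonpos_theta (hB : IsTTSP B c d) (hB' : IsTTSP B' c d) (hd : Disjoint B B')
    (hV : ∀ w : V, (∃ e ∈ B, w ∈ e) → (∃ e ∈ B', w ∈ e) → w = c ∨ w = d) (hy : s(uy, vy) ∈ B) (hz : s(uz, vz) ∈ B')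
    (hx : s(c, d) ∉ B ∪ B')
    (hMy : My ⊆ B.erase s(uy, vy)) (hCy : Cy ⊆ B.erase s(uy, vy)) (hMz : Mz ⊆ B'.erase s(uz, vz)) (hCz : Cz ⊆ B'.erase s(uz, vz))
    {g : Finset (Sym2 V) → ℝ} (hgx : ∀ A : Finset (Sym2 V), g (insert s(c, d) A) = g A)
    (hgy : ∀ A : Finset (Sym2 V), g (insert s(uy, vy) A) = g A) (hgz : ∀ A : Finset (Sym2 V), g (insert s(uz, vz) A) = g A)
    (hmono : ∀ ⦃X Y : Finset (Sym2 V)⦄, X ⊆ Y → g X ≤ g Y) (J : ℕ) :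
    ∑ γ ∈ (insert s(c, d) (insert s(uy, vy) (insert s(uz, vz) (My ∪ Mz)))).powerset with
        apExpC (insert s(c, d) (insert s(uy, vy) (insert s(uz, vz) (My ∪ Mz)))) (Cy ∪ Cz) γ ≤ J,
        ((((fun X : Finset (Sym2 V) => if (s(c, d) ∈ X ∧ s(uy, vy) ∈ X) ∨ (s(c, d) ∈ X ∧ s(uz, vz) ∈ X) ∨
              (s(uy, vy) ∈ X ∧ s(uz, vz) ∈ X) then (1 : ℝ) else 0) (γ ∪ (Cy ∪ Cz))) -
            ((fun X : Finset (Sym2 V) => if (s(c, d) ∈ X ∧ s(uy, vy) ∈ X) ∨ (s(c, d) ∈ X ∧ s(uz, vz) ∈ X) ∨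
              (s(uy, vy) ∈ X ∧ s(uz, vz) ∈ X) then (1 : ℝ) else 0)
                ((insert s(c, d) (insert s(uy, vy) (insert s(uz, vz) (My ∪ Mz)))) \ γ ∪ (Cy ∪ Cz)))) *
          (g (γ ∪ (Cy ∪ Cz)) - g ((insert s(c, d) (insert s(uy, vy) (insert s(uz, vz) (My ∪ Mz)))) \ γ ∪ (Cy ∪ Cz)))) ≤ 0 := by
  have hxB : s(c, d) ∉ B := fun h => hx (Finset.mem_union_left _ h)
  have hxB' : s(c, d) ∉ B' := fun h => hx (Finset.mem_union_right _ h)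
  have hMyB : My ⊆ B := hMy.trans (Finset.erase_subset _ _)
  have hMzB : Mz ⊆ B' := hMz.trans (Finset.erase_subset _ _)
  have hCyB : Cy ⊆ B := hCy.trans (Finset.erase_subset _ _)
  have hCzB : Cz ⊆ B' := hCz.trans (Finset.erase_subset _ _)
  have hyB' : s(uy, vy) ∉ B' := Finset.disjoint_left.1 hd hy
  have hzB : s(uz, vz) ∉ B := Finset.disjoint_right.1 hd hz
  refine maj3_levels_le_nonpos_of_rootFact (M := My ∪ Mz) (C := Cy ∪ Cz) ?_ ?_ ?_ ?_ ?_ ?_ ?_ ?_ ?_ ?_ hgx hgy hgz hmono J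
  · rw [Finset.mem_union, not_or]; exact ⟨fun h => hxB (hMyB h), fun h => hxB' (hMzB h)⟩
  · rw [Finset.mem_union, not_or]; exact ⟨fun h => (Finset.mem_erase.1 (hMy h)).1 rfl, fun h => hyB' (hMzB h)⟩
  · rw [Finset.mem_union, not_or]; exact ⟨fun h => hzB (hMyB h), fun h => (Finset.mem_erase.1 (hMz h)).1 rfl⟩
  · rw [Finset.mem_union, not_or]; exact ⟨fun h => hxB (hCyB h), fun h => hxB' (hCzB h)⟩
  · rw [Finset.mem_union, not_or]; exact ⟨fun h => (Finset.mem_erase.1 (hCy h)).1 rfl, fun h => hyB' (hCzB h)⟩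
  · rw [Finset.mem_union, not_or]; exact ⟨fun h => hzB (hCyB h), fun h => (Finset.mem_erase.1 (hCz h)).1 rfl⟩
  · exact fun h => hxB (h ▸ hy)
  · exact fun h => hxB' (h ▸ hz)
  · exact fun h => hyB' (h ▸ hz)
  · exact fun h mh nh J => realPairEnv_Mt_nonneg hB hB' hd hV hy hz hMy hCy hMz hCz mh mh nh (fun _ => le_rfl) J

end Theta


end RootForm

end FK

end Summit.CriticalPhenomena.PercolationContinuityZ3.Theorems

end
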